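import Summits.Ventures.HSemireg.WedgeHankelRecurrenceGaussResultantGapTwo

/-!
# Venture HSemireg — **A LOWER BOUND FOR THE DISCRIMINANT OF A POSITIVE RECURRENCE: `disc(q_{t+1}) ≥ (t+1)^{t+1} ∏_{j<t} b_{j+1}^{t−j}`**, with EQUALITY for the Chebyshev polynomials
# of the first kind (`b_1 = ½`, `b_j = ¼`): by N410 `(∏_k λ_k) disc(q_{t+1}) = ∏ b_{j+1}^{t−j}` with the Christoffel numbers `λ_k > 0`, `Σ λ_k = 1` (N266), and AM–GM
# `∏_k λ_k ≤ (1∕(t+1))^{t+1}` (equality iff all `λ_k` are equal, as for Gauss–Chebyshev)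

HONEST FRAMING. Part of the Lean index of the computation cell `pub-hsemireg` (seat p10 gen 47, Sunday typer «UNIFORM-IN-n»).  Real polynomials, `Polynomial.discr`, finite sums ∕ products and
Mathlib's AM–GM (`Real.geom_mean_le_arith_mean_weighted`) only; no variety, no cohomology theory, no sheaf, no Ext group and no semiregularity map is constructed here; nothing here says that
HC / HC_CM / HC_AV holds; no Literature fact (unproved `Prop`) is declared or used.  Custodian versions as in `WedgeHankelSiegelIdeal` (1/3).
SOURCES (cited).  The inequality is a COROLLARY typed here of Szegő (3.4.7)–(3.4.8) (Christoffel numbers, `Σ λ_ν = μ_0`), Schur 1931 §1 (via N403 ∕ N410) and the AM–GM inequality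
(Hardy–Littlewood–Pólya, *Inequalities*, Thm 9); the equality case is Szegő (6.71.5) at `α = β = −½` ∕ Rivlin Ex. 1.5 (`disc T̃_{t+1} = (t+1)^{t+1} 2^{−t²}`, N407) together with the equal
Gauss–Chebyshev weights `π∕(t+1)`.  No separate printed locator for the inequality is claimed.
PROOF TYPED HERE.  N266 `favard_finite_explicit` (positivity, total mass `1`) for the nodes of N247, identified with any strictly increasing enumeration by N294 `strictMono_eq_of_prod_X_sub_C_eq`;
N410 `christoffel_numbers_prod_mul_discr`; AM–GM with equal weights `1∕(t+1)` and `(x^{1∕(t+1)})^{t+1} = x`; the Chebyshev product `∏_{j<t} b_{j+1}^{t−j} = 2^{−t²}` by `Finset.sum_range_id_mul_two`.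
DEDUP DISCLOSURE (`rg -n -i 'discr_ge|discr_lower|geom_mean' Summits/Ventures/HSemireg`, 2026-09-04): nothing; 0 hits for the 4 names below.

WHAT IS IN THE TREE.  N410 `christoffel_numbers_prod_mul_discr`, `recurrence_discr_pos`; N266 `favard_finite_explicit`; N247 `recurrence_monic_natDegree`, `eq_prod_X_sub_C_of_monic_of_roots`;
N294 `strictMono_eq_of_prod_X_sub_C_eq`; N407 `chebyshev_nodes_discr`; N3xx `chebyshev_recurrence_eq_prod`; Mathlib `Real.geom_mean_le_arith_mean_weighted`, `Real.rpow_inv_natCast_pow`,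
`Real.finsetProd_rpow`, `Finset.sum_range_id_mul_two`.
THIS FILE (namespace `Summit.Ventures.HSemireg.Wedge.HankelOuter` continued; CHAINED on N421 (import only); 0 definitions):
* §1187 `prod_le_inv_pow_of_sum_eq_one` (AM–GM: `z ≥ 0`, `Σ z = 1` ⇒ `∏ z ≤ (t+1)^{−(t+1)}`), **`recurrence_discr_ge`** (`(t+1)^{t+1} ∏_{j<t} b_{j+1}^{t−j} ≤ disc q_{t+1}`),
  `chebyshev_couplings_prod` (`∏_{j<t} b_{j+1}^{t−j} = (½)^{t²}` for `b_1 = ½`, `b_{j+2} = ¼`), **`chebyshev_discr_eq_lower_bound`** (equality for `T̃_{t+1}`).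
CAVEATS.  `b > 0`; the equality characterisation (all Christoffel numbers equal) is only exhibited, not proved to be necessary.  Nothing Ext-side.  New names only.
-/

open Module Polynomial Real
open scoped Matrix Polynomial

namespace Summit.Ventures.HSemireg.Wedge.HankelOuter

/-! ## §1187. `disc(q_{t+1}) ≥ (t+1)^{t+1} ∏ b_{j+1}^{t−j}` -/

/-- **AM–GM: `z_k ≥ 0`, `Σ_k z_k = 1` on `Fin (t+1)` ⇒ `∏_k z_k ≤ ((t+1)⁻¹)^{t+1}`.** [Hardy–Littlewood–Pólya Thm 9; this file, §1187] -/
theorem prod_le_inv_pow_of_sum_eq_one {t : ℕ} {z : Fin (t + 1) → ℝ} (hz : ∀ k, 0 ≤ z k) (hsum : ∑ k, z k = 1) :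
    ∏ k, z k ≤ (((t : ℝ) + 1)⁻¹) ^ (t + 1) := by
  have ht : (0 : ℝ) < (t : ℝ) + 1 := by positivity
  have hw : ∑ _k : Fin (t + 1), ((t : ℝ) + 1)⁻¹ = 1 := by
    rw [Finset.sum_const, Finset.card_univ, Fintype.card_fin, nsmul_eq_mul]; push_cast; field_simp
  have hag := Real.geom_mean_le_arith_mean_weighted (s := Finset.univ) (fun _ : Fin (t + 1) => ((t : ℝ) + 1)⁻¹) z (fun _ _ => by positivity) hw (fun k _ => hz k)
  rw [← Finset.mul_sum, hsum, mul_one] at hag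
  have hprod : ∏ k, z k = (∏ k, z k ^ ((t : ℝ) + 1)⁻¹) ^ (t + 1) := by
    rw [← Finset.prod_pow]
    refine Finset.prod_congr rfl fun k _ => ?_
    rw [show ((t : ℝ) + 1)⁻¹ = ((t + 1 : ℕ) : ℝ)⁻¹ by push_cast; rfl, Real.rpow_inv_natCast_pow (hz k) (Nat.succ_ne_zero t)]
  rw [hprod]
  exact pow_le_pow_left₀ (Finset.prod_nonneg fun k _ => Real.rpow_nonneg (hz k) _) hag (t + 1)

/-- **`(t+1)^{t+1} · ∏_{j<t} b_{j+1}^{t−j} ≤ disc(q_{t+1})` for every positive recurrence.** [corollary of Szegő (3.4.7)–(3.4.8), Schur 1931 and AM–GM; this file, §1187] -/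
theorem recurrence_discr_ge {q : ℕ → ℝ[X]} {a b : ℕ → ℝ} (hq0 : q 0 = 1) (hq1 : q 1 = Polynomial.X - C (a 0))
    (hrec : ∀ n, q (n + 2) = (Polynomial.X - C (a (n + 1))) * q (n + 1) - C (b (n + 1)) * q n) (hb : ∀ j, 0 < b j) (t : ℕ) :
    ((t : ℝ) + 1) ^ (t + 1) * ∏ j ∈ Finset.range t, b (j + 1) ^ (t - j) ≤ (q (t + 1)).discr := by
  obtain ⟨z, hz, hzr, hpos, hsum, -⟩ := favard_finite_explicit hq0 hq1 hrec hb t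
  obtain ⟨hm, hd⟩ := recurrence_monic_natDegree hq0 hq1 hrec (t + 1)
  have hzq := eq_prod_X_sub_C_of_monic_of_roots hm hd hz.injective hzr
  have hprod := christoffel_numbers_prod_mul_discr hq0 hq1 hrec hb hz hzq
  have hag := prod_le_inv_pow_of_sum_eq_one (fun k => (hpos k).le) hsum
  have hdisc := (recurrence_discr_pos hq0 hq1 hrec hb t).le
  have ht : (0 : ℝ) < (t : ℝ) + 1 := by positivity
  calc ((t : ℝ) + 1) ^ (t + 1) * ∏ j ∈ Finset.range t, b (j + 1) ^ (t - j)
      = ((t : ℝ) + 1) ^ (t + 1) * ((∏ k, (∏ l ∈ Finset.Ico 1 (t + 1), b l) / ((derivative (q (t + 1))).eval (z k) * (q t).eval (z k))) * (q (t + 1)).discr) := by rw [hprod]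
    _ ≤ ((t : ℝ) + 1) ^ (t + 1) * ((((t : ℝ) + 1)⁻¹) ^ (t + 1) * (q (t + 1)).discr) :=
        mul_le_mul_of_nonneg_left (mul_le_mul_of_nonneg_right hag hdisc) (pow_nonneg ht.le _)
    _ = (q (t + 1)).discr := by rw [← mul_assoc, ← mul_pow, mul_inv_cancel₀ ht.ne', one_pow, one_mul]

/-- `∏_{j<t} b_{j+1}^{t−j} = (½)^{t²}` for the Chebyshev-`T` couplings `b_1 = ½`, `b_{j+2} = ¼`. [bookkeeping; this file, §1187] -/
theorem chebyshev_couplings_prod {b : ℕ → ℝ} (hb1 : b 1 = 1 / 2) (hb : ∀ n, b (n + 2) = 1 / 4) (t : ℕ) :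
    ∏ j ∈ Finset.range t, b (j + 1) ^ (t - j) = (1 / 2 : ℝ) ^ (t ^ 2) := by
  rcases t with _ | t
  · simp
  rw [Finset.prod_range_succ', zero_add, hb1, Nat.sub_zero]
  rw [Finset.prod_congr rfl fun j _ => by rw [show j + 1 + 1 = j + 2 from rfl, hb j, show (1 / 4 : ℝ) = (1 / 2) ^ 2 by norm_num, ← pow_mul], Finset.prod_pow_eq_pow_sum, ← pow_add]
  congr 1
  have h2 := Finset.sum_range_id_mul_two t
  have hsum : ∑ j ∈ Finset.range t, 2 * (t + 1 - (j + 1)) = ∑ j ∈ Finset.range t, 2 * (t - j) := Finset.sum_congr rfl fun j _ => by omega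
  have hrefl : ∑ j ∈ Finset.range t, (t - j) = ∑ j ∈ Finset.range t, (j + 1) := by
    rw [← Finset.sum_range_reflect (fun j => j + 1) t]
    exact Finset.sum_congr rfl fun j hj => by have := Finset.mem_range.1 hj; omega
  rw [hsum, ← Finset.mul_sum, hrefl, Finset.sum_add_distrib, Finset.sum_const, Finset.card_range, smul_eq_mul, mul_one]
  have : (∑ i ∈ Finset.range t, i) * 2 = t * (t - 1) := h2
  rcases t with _ | s
  · simp
  · rw [Nat.add_sub_cancel] at this
    nlinarith [this]

/-- **EQUALITY FOR CHEBYSHEV `T`: `disc(T̃_{t+1}) = (t+1)^{t+1} ∏_{j<t} b_{j+1}^{t−j}`** (`= (t+1)^{t+1} 2^{−t²}`; all Gauss–Chebyshev weights equal `1∕(t+1)`). [Szegő (6.71.5), Rivlin Ex.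
1.5; this file, §1187] -/
theorem chebyshev_discr_eq_lower_bound {q : ℕ → ℝ[X]} {a b : ℕ → ℝ} (hq0 : q 0 = 1) (hq1 : q 1 = Polynomial.X - C (a 0))
    (hrec : ∀ n, q (n + 2) = (Polynomial.X - C (a (n + 1))) * q (n + 1) - C (b (n + 1)) * q n) (ha : ∀ n, a n = 0) (hb1 : b 1 = 1 / 2)
    (hb : ∀ n, b (n + 2) = 1 / 4) (t : ℕ) :
    (q (t + 1)).discr = ((t : ℝ) + 1) ^ (t + 1) * ∏ j ∈ Finset.range t, b (j + 1) ^ (t - j) := by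
  rw [chebyshev_couplings_prod hb1 hb, chebyshev_recurrence_eq_prod hq0 hq1 hrec ha hb1 hb t, discr_prod_X_sub_C, chebyshev_nodes_discr]

end Summit.Ventures.HSemireg.Wedge.HankelOuter
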